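import Literature.NumberTheory.Automorphic.UnramifiedOrbitalUnitFactor
import Literature.NumberTheory.Automorphic.UnramifiedOrbitSetHermitian
import Literature.NumberTheory.Rogawski1990.RegularEltLocalisation
import Literature.NumberTheory.Automorphic.GodementHeightFloor
import HarnessLib

/-!
# The orbital Euler product at a regular rational class of `U(H)`, `H` hermitian anisotropic, from ADMISSIBILITY ON THE REGULAR
# CLASSES and a NORMALISING EXCEPTIONAL SET — the kit-level Euler lemma, kit-free (Rogawski (1990) §4.3 p. 44, §5.4 p. 72)

Topic `NumberTheory/Automorphic`; namespace `Literature.NumberTheory.Automorphic.UnitaryGroup`; THEOREMS ONLY (no definition, no instance,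
no named fact, no `sorry`).

WHY.  The T1 engine line of the cell (`Cruxes/H413/Lines/F0_T1InnerFormTraceIdentity.lean`, ED 1.19b₁) pins, for its comparison kit, local
class-indexed orbital measure families `m^{G′}_v` on `U(H)(L⁺_v)` ADMISSIBLE ON THE REGULAR CLASSES (pin (xi″):
`(mG v).IsAdmissibleOn (IsRegularElt ·)`), an archimedean family `m^{G′}_∞` admissible on the regular classes (pin (ix′)), and at every
REGULAR rational class a finite exceptional set off which the local family is normalised (pin (xiv): `∃ S₀, IsNormalisedOff L 3 H mG γ S₀`);
its J side is keyed to ★ `AdelicOrbitalMeasureFamily.ofLocal mG mGi` (β-socket (viii‴): `μA c = ofReal (α 𝒪) • ofLocal mG mGi c` at the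
regular classes).  The SJ sockets of the next edition read the orbital integrals of a pure smooth tensor `f′ = f_∞ ⊗ ⊗_v f_v` as EULER
PRODUCTS.  ★ (S) `UnitaryGroup.exists_finset_adelicClassOrbitalIntegral_ofLocal_eval_eq_mul_prod` delivers exactly that, but from (a) the
named fact `UnramifiedOrbitSetAE L N H` (Kottwitz's orbit lemma, since PROVED for hermitian non-degenerate `H`: ★
`unramifiedOrbitSetAE_of_hermitian`), (b) the per-class admissibility triples `m ⟦γ_v⟧ ≠ 0 ∧ invariant ∧ finite on compacta` (read off
admissibility on the regular classes by ★ `Rogawski1990.isAdmissibleOn_at_toLocal_toAdelic` ∕ `…_at_archPart_toAdelic`), and (c) a given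
normalising set.  This file composes them ONCE, in the shapes the pins hand over, so the line's kit-level lemma
`ComparisonKit.IsPinned.adelicClassOrbitalIntegral_ofLocal_eq_mul_prod` is a three-line fold (the Lines module is deliberately NOT imported
here: its editions must stay free to grow `IsPinned`):

* §1 **`exists_finset_adelicClassOrbitalIntegral_ofLocal_eval_eq_mul_prod_of_isAdmissibleOn`** — for `H` hermitian anisotropic (any rank `N`),
  `mG v` ∕ `mGi` admissible on the regular classes, a rational class `c` with `out c` regular and `∃ S₀` normalising at `toAdelic (out c)`, and
  an `IsTest` pure tensor `T`: `∃ S₂ ⊇ T.S` finite with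
  `Φ_{ofLocal mG mGi}(c, T.eval) = Φ_{mGi}(⟦γ_∞⟧, T.arch) · ∏_{v ∈ S₂} Φ_{mG v}(⟦γ_v⟧, T.loc v)` (conclusion = ★ (S)'s verbatim).
* §0 `adelicClassOrbitalIntegral_eq_toReal_mul_of_eq_smul` — `μA c = a • m c ⇒ Φ_{μA}(c, f) = a.toReal · Φ_m(c, f)` (★ `orbitalIntegral_smul_measure`).
* §2 **`exists_finset_adelicClassOrbitalIntegral_eq_mul_prod_of_eq_smul_ofLocal`** — the same for ANY adelic family `μA` with
  `μA c = a • ofLocal mG mGi c` (`a : ℝ≥0∞`; the β-socket shape): `Φ_{μA}(c, T.eval) = a.toReal · Φ_∞ · ∏_{v ∈ S₂} Φ_v`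
  (★ `orbitalIntegral_smul_measure`), and `…_of_eq_ofReal_smul_ofLocal` for `a = ENNReal.ofReal r`, `0 ≤ r` (the stable-class weights are
  positive reals): `Φ_{μA}(c, T.eval) = r · Φ_∞ · ∏ Φ_v`.

* §3 (ed. 2) the same WITH THE UNIT-FACTOR CLAUSE `∀ v ∉ S₂, Φ_v = 1` (`exists_finset_forall_loc_eq_one_and_ofLocal_eval_eq_mul_prod_…`), in the
  `∃ S₁ ⊇ T.S, ∀ S ⊇ S₁` shape of ★ `MatchingAdeleG.exists_isEulerOnClasses_ofLocalAdelic` (`exists_finset_forall_ofLocal_eval_eq_mul_prod_of_subset_…`), and as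
  the junk-free finite product `Φ = Φ_∞ · ∏ᶠ_v Φ_v` with `mulSupport` finite (`mulSupport_finite_and_ofLocal_eval_eq_mul_finprod_…`).

* §4 (ed. 3) THE J-TERM: `adelicStableOrbitalIntegral (ofLocal mG mGi) T.eval 𝒪_st(γ₀) = Σᶠ_{c ⊂ 𝒪_st(γ₀)} Φ_∞(c) · ∏ᶠ_v Φ_v(c)` at a regular stable class
  (`adelicStableOrbitalIntegral_ofLocal_eval_stableClassOf_eq_finsum_mul_finprod_…`), the rescaling on a stable class (`…_eq_toReal_mul_of_forall_eq_smul`), and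
  the β-socket reading `Φ^st_{μA} = r · Σᶠ Φ_∞ ∏ᶠ Φ_v` (`…_eq_mul_finsum_mul_finprod_of_forall_eq_ofReal_smul_ofLocal`).

FOLD (for the LEAD of the T1 line, ED 1.19c; `h : 𝔨.IsPinned ν Tinf νH νG νGi νqi νHi`, Borel `letI`∕`haveI ⟨rfl⟩` lines as in
`IsPinned.exists_measures_isLocalInnerTransfer`):
`exists_finset_adelicClassOrbitalIntegral_ofLocal_eval_eq_mul_prod_of_isAdmissibleOn L 3 H 𝔨.mG 𝔨.mGi c hanis hherm (fun v => ((h.deltaTransfer).1 v).2.2) h.transfer_arch.1 hc (h.normalisedOff c hc) T hT`.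

HONEST LABEL: HC_CM is proved only modulo the printed citations until rung 0 closes; this file closes no stub and moves no floor digit.

## References
* J. D. Rogawski, *Automorphic Representations of Unitary Groups in Three Variables*, Ann. of Math. Stud. 123 (1990), §4.3 p. 44, §5.4 (5.4.3)
  p. 72, §14.5 p. 237 [Rogawski1990].
* R. E. Kottwitz, *Stable trace formula: elliptic singular terms*, Math. Ann. 275 (1986), Prop. 7.1, Cor. 7.3 [Kottwitz1986].
-/

set_option autoImplicit false

noncomputable section

open MeasureTheory Measure NumberField IsDedekindDomain
open scoped ENNReal NNReal

namespace Literature.NumberTheory.Automorphic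

namespace UnitaryGroup

open Literature.NumberTheory.Rogawski1990
open Literature.AlgebraicGeometry.ShimuraVarieties (hermForm)

/-! ## §0′ (ed. 3) Regularity inside a stable class -/

section Regular

variable (L : Type) [Field L] [NumberField L] [IsCMField L] (N : ℕ) (H : Matrix (Fin N) (Fin N) L)

/-- Stably conjugate to a regular element ⇒ the chosen representative of the class is regular: `c ∈ conjClassesIn γ₀`, `γ₀` regular ⇒ `out c` regular
(★ `mk_mem_conjClassesIn_iff`, ★ `isRegularElt_of_isConj` twice). [cite: Rogawski1990, §3.1 p. 19; §4.1 (4.1.1) p. 39] -/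
theorem isRegularElt_out_of_mem_conjClassesIn {γ₀ : (cmDatum L N H).Rational} (hγ₀ : IsRegularElt (γ₀.val : GL (Fin N) L))
    {c : ConjClasses (cmDatum L N H).Rational} (hc : c ∈ conjClassesIn (cmConjRingHom L) H γ₀) :
    IsRegularElt ((Quotient.out c).val : GL (Fin N) L) := by
  obtain ⟨δ, rfl⟩ := ConjClasses.mk_surjective c
  exact isRegularElt_of_isConj (isStablyConj_of_isConj (isConj_out_conjClasses_mk δ))
    (isRegularElt_of_isConj (mk_mem_conjClassesIn_iff.1 hc) hγ₀)

end Regular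

/-! ## §0 Rescaling an adelic family at a class -/

section Rescale

variable (L : Type) [Field L] [NumberField L] [IsCMField L] (N : ℕ) (H : Matrix (Fin N) (Fin N) L)
  [∀ g : (cmDatum L N H).Adelic, MeasurableSpace ((cmDatum L N H).Adelic ⧸ Subgroup.centralizer ({g} : Set (cmDatum L N H).Adelic))]
  (c : ConjClasses (cmDatum L N H).Rational)

/-- **Rescaling the adelic orbital measure at a class rescales the class orbital integral**: if `μA c = a • m c` then
`Φ_{μA}(c, f) = a.toReal · Φ_m(c, f)` (★ `orbitalIntegral_smul_measure`). [cite: Rogawski1990, §5.4 (5.4.3) p. 72] -/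
theorem adelicClassOrbitalIntegral_eq_toReal_mul_of_eq_smul (μA m : AdelicOrbitalMeasureFamily L N H) (a : ℝ≥0∞)
    (hμA : μA c = a • m c) (f : (cmDatum L N H).Adelic → ℂ) :
    adelicClassOrbitalIntegral L N H μA f c = (a.toReal : ℂ) * adelicClassOrbitalIntegral L N H m f c := by
  rw [adelicClassOrbitalIntegral, adelicClassOrbitalIntegral, classOrbitalIntegralAlong_eq, classOrbitalIntegralAlong_eq, hμA,
    orbitalIntegral_smul_measure, Complex.real_smul]

/-- **A family that is a CONSTANT multiple of another on a stable class has the rescaled stable orbital sum**: `μA c = a • m c` for every class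
`c ⊂ 𝒪_st(γ₀)` ⇒ `Φ^st_{μA}(𝒪_st(γ₀), f) = a.toReal · Φ^st_m(𝒪_st(γ₀), f)` — no finiteness of support needed (`ℂ` has no zero divisors, Mathlib
`mul_finsum_mem`).  The T1 line's β-socket (viii‴) keys `μA` to `ofLocal` by the weight `α(𝒪_st)`, constant on the stable class.
[cite: Rogawski1990, §5.4 (5.4.3) p. 72; §14.5 p. 238] -/
theorem adelicStableOrbitalIntegral_stableClassOf_eq_toReal_mul_of_forall_eq_smul (μA m : AdelicOrbitalMeasureFamily L N H) (a : ℝ≥0∞)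
    {γ₀ : (cmDatum L N H).Rational} (hμA : ∀ c ∈ conjClassesIn (cmConjRingHom L) H γ₀, μA c = a • m c) (f : (cmDatum L N H).Adelic → ℂ) :
    adelicStableOrbitalIntegral L N H μA f (stableClassOf (cmConjRingHom L) H γ₀) =
      (a.toReal : ℂ) * adelicStableOrbitalIntegral L N H m f (stableClassOf (cmConjRingHom L) H γ₀) := by
  rw [adelicStableOrbitalIntegral_stableClassOf, adelicStableOrbitalIntegral_stableClassOf, stableOrbitalSum, stableOrbitalSum, mul_finsum_mem]
  exact finsum_mem_congr rfl fun c hc => adelicClassOrbitalIntegral_eq_toReal_mul_of_eq_smul L N H c μA m a (hμA c hc) f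

end Rescale

section Euler

variable (L : Type) [Field L] [NumberField L] [IsCMField L] (N : ℕ) (H : Matrix (Fin N) (Fin N) L)
  [∀ (v : HeightOneSpectrum (𝓞 ↥(maximalRealSubfield L))) (x : (cmDatum L N H).Local v),
    MeasurableSpace ((cmDatum L N H).Local v ⧸ Subgroup.centralizer ({x} : Set ((cmDatum L N H).Local v)))]
  [∀ (v : HeightOneSpectrum (𝓞 ↥(maximalRealSubfield L))) (x : (cmDatum L N H).Local v),
    BorelSpace ((cmDatum L N H).Local v ⧸ Subgroup.centralizer ({x} : Set ((cmDatum L N H).Local v)))]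
  (mG : ∀ v : HeightOneSpectrum (𝓞 ↥(maximalRealSubfield L)), OrbitalMeasureFamily ((cmDatum L N H).Local v))
  [∀ g : (cmDatum L N H).Adelic, MeasurableSpace ((cmDatum L N H).Adelic ⧸ Subgroup.centralizer ({g} : Set (cmDatum L N H).Adelic))]
  [∀ g : (cmDatum L N H).Adelic, BorelSpace ((cmDatum L N H).Adelic ⧸ Subgroup.centralizer ({g} : Set (cmDatum L N H).Adelic))]
  [∀ a : arch (↥(maximalRealSubfield L)) L (IsCMField.complexConj L) N H,
    MeasurableSpace (arch (↥(maximalRealSubfield L)) L (IsCMField.complexConj L) N H ⧸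
      Subgroup.centralizer ({a} : Set (arch (↥(maximalRealSubfield L)) L (IsCMField.complexConj L) N H)))]
  [∀ a : arch (↥(maximalRealSubfield L)) L (IsCMField.complexConj L) N H,
    BorelSpace (arch (↥(maximalRealSubfield L)) L (IsCMField.complexConj L) N H ⧸
      Subgroup.centralizer ({a} : Set (arch (↥(maximalRealSubfield L)) L (IsCMField.complexConj L) N H)))]
  (mGi : OrbitalMeasureFamily (arch (↥(maximalRealSubfield L)) L (IsCMField.complexConj L) N H))
  (c : ConjClasses (cmDatum L N H).Rational)

/-! ## §1 The Euler product at a regular class from admissibility on the regular classes -/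

/-- **THE ORBITAL EULER PRODUCT AT A REGULAR RATIONAL CLASS, FROM THE PINS' SHAPES.**  `H` hermitian for the CM conjugation and anisotropic;
local class-indexed orbital measure families `mG v` on `U(H)(L⁺_v)` admissible on the regular classes; an archimedean family `mGi` on
`U(H)(L ⊗ ℝ)` admissible on the regular classes; a rational class `c` whose representative `out c` is regular semisimple, at which the local
family is normalised off SOME finite set (`γ = toAdelic (out c)`, `γ_v = toLocal v γ`, `γ_∞ = archPart γ`); an `IsTest` pure tensor
`T = f_∞ ⊗ ⊗_v f_v`.  Then for a finite `S₂ ⊇ T.S`: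
`Φ_{ofLocal mG mGi}(c, T.eval) = Φ_{mGi}(⟦γ_∞⟧, f_∞) · ∏_{v ∈ S₂} Φ_{mG v}(⟦γ_v⟧, f_v)` — ★ (S) with Kottwitz's orbit lemma DISCHARGED
(★ `unramifiedOrbitSetAE_of_hermitian`, `det H ≠ 0` by ★ `Godement.det_ne_zero_of_anisotropic`) and the per-class admissibility triples read
off the regular-class admissibility (★ `isAdmissibleOn_at_toLocal_toAdelic` ∕ `isAdmissibleOn_at_archPart_toAdelic`).
[cite: Rogawski1990, §4.3 p. 44; §5.4 (5.4.3) p. 72] [cite: Kottwitz1986, Cor. 7.3] -/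
theorem exists_finset_adelicClassOrbitalIntegral_ofLocal_eval_eq_mul_prod_of_isAdmissibleOn
    (hanis : ∀ x : Fin N → L, hermForm (cmConjRingHom L) H x x = 0 → x = 0)
    (hherm : (H.map (cmConjRingHom L)).transpose = H)
    (hadm : ∀ v, (mG v).IsAdmissibleOn fun x => IsRegularElt (x.val : GL (Fin N) (LocalRing L v)))
    (hadmA : mGi.IsAdmissibleOn fun a => IsRegularElt (a.val : GL (Fin N) (mixedEmbedding.mixedSpace L)))
    (hc : IsRegularElt ((Quotient.out c).val : GL (Fin N) L))
    (hnorm : ∃ S₀ : Finset (HeightOneSpectrum (𝓞 ↥(maximalRealSubfield L))),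
      IsNormalisedOff L N H mG ((cmDatum L N H).toAdelic (Quotient.out c)) S₀)
    (T : PureTensor L N H) (hT : T.IsTest) :
    ∃ S₂ : Finset (HeightOneSpectrum (𝓞 ↥(maximalRealSubfield L))), T.S ⊆ S₂ ∧
      adelicClassOrbitalIntegral L N H (AdelicOrbitalMeasureFamily.ofLocal L N H mG mGi) T.eval c =
        classOrbitalIntegral mGi T.arch
            (ConjClasses.mk (archPart (↥(maximalRealSubfield L)) L (IsCMField.complexConj L) N H ((cmDatum L N H).toAdelic (Quotient.out c)))) *
          ∏ v ∈ S₂, classOrbitalIntegral (mG v) (T.loc v) (ConjClasses.mk ((cmDatum L N H).toLocal v ((cmDatum L N H).toAdelic (Quotient.out c)))) := by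
  obtain ⟨S₀, hS₀⟩ := hnorm
  exact exists_finset_adelicClassOrbitalIntegral_ofLocal_eval_eq_mul_prod L N H mG mGi c hanis
    (unramifiedOrbitSetAE_of_hermitian L N H hherm (Godement.det_ne_zero_of_anisotropic L H hanis)) hc hS₀
    (fun v => isAdmissibleOn_at_toLocal_toAdelic L H v (hadm v) (Quotient.out c) hc)
    (isAdmissibleOn_at_archPart_toAdelic L H hadmA (Quotient.out c) hc) T hT

/-! ## §2 The same for a family that IS a scalar multiple of `ofLocal` at the class (β-socket shape `μA c = a • ofLocal mG mGi c`) -/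

/-- **THE ORBITAL EULER PRODUCT FOR A WEIGHTED FAMILY** `μA` with `μA c = a • ofLocal mG mGi c` at the regular class `c` (`a : ℝ≥0∞`; the
T1 line's β-socket keys its J-side family this way, `a = ofReal (α 𝒪_st(c))`): under the hypotheses of §1,
`Φ_{μA}(c, T.eval) = a.toReal · Φ_{mGi}(⟦γ_∞⟧, f_∞) · ∏_{v ∈ S₂} Φ_{mG v}(⟦γ_v⟧, f_v)` for a finite `S₂ ⊇ T.S`.
[cite: Rogawski1990, §5.4 (5.4.3) p. 72; §14.5 p. 237] [cite: Kottwitz1986, Cor. 7.3] -/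
theorem exists_finset_adelicClassOrbitalIntegral_eq_mul_prod_of_eq_smul_ofLocal
    (hanis : ∀ x : Fin N → L, hermForm (cmConjRingHom L) H x x = 0 → x = 0)
    (hherm : (H.map (cmConjRingHom L)).transpose = H)
    (hadm : ∀ v, (mG v).IsAdmissibleOn fun x => IsRegularElt (x.val : GL (Fin N) (LocalRing L v)))
    (hadmA : mGi.IsAdmissibleOn fun a => IsRegularElt (a.val : GL (Fin N) (mixedEmbedding.mixedSpace L)))
    (hc : IsRegularElt ((Quotient.out c).val : GL (Fin N) L))
    (hnorm : ∃ S₀ : Finset (HeightOneSpectrum (𝓞 ↥(maximalRealSubfield L))),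
      IsNormalisedOff L N H mG ((cmDatum L N H).toAdelic (Quotient.out c)) S₀)
    (μA : AdelicOrbitalMeasureFamily L N H) (a : ℝ≥0∞) (hμA : μA c = a • AdelicOrbitalMeasureFamily.ofLocal L N H mG mGi c)
    (T : PureTensor L N H) (hT : T.IsTest) :
    ∃ S₂ : Finset (HeightOneSpectrum (𝓞 ↥(maximalRealSubfield L))), T.S ⊆ S₂ ∧
      adelicClassOrbitalIntegral L N H μA T.eval c =
        (a.toReal : ℂ) *
          (classOrbitalIntegral mGi T.arch
              (ConjClasses.mk (archPart (↥(maximalRealSubfield L)) L (IsCMField.complexConj L) N H ((cmDatum L N H).toAdelic (Quotient.out c)))) *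
            ∏ v ∈ S₂, classOrbitalIntegral (mG v) (T.loc v)
              (ConjClasses.mk ((cmDatum L N H).toLocal v ((cmDatum L N H).toAdelic (Quotient.out c))))) := by
  obtain ⟨S₂, hS₂, hprod⟩ := exists_finset_adelicClassOrbitalIntegral_ofLocal_eval_eq_mul_prod_of_isAdmissibleOn L N H mG mGi c hanis hherm
    hadm hadmA hc hnorm T hT
  refine ⟨S₂, hS₂, ?_⟩
  rw [adelicClassOrbitalIntegral_eq_toReal_mul_of_eq_smul L N H c μA (AdelicOrbitalMeasureFamily.ofLocal L N H mG mGi) a hμA, hprod]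

/-- **The weighted Euler product with a non-negative REAL weight** `μA c = ENNReal.ofReal r • ofLocal mG mGi c`, `0 ≤ r` (positive stable-class
weights `α`): `Φ_{μA}(c, T.eval) = r · Φ_{mGi}(⟦γ_∞⟧, f_∞) · ∏_{v ∈ S₂} Φ_{mG v}(⟦γ_v⟧, f_v)`.
[cite: Rogawski1990, §5.4 (5.4.3) p. 72; §14.5 p. 237] [cite: Kottwitz1986, Cor. 7.3] -/
theorem exists_finset_adelicClassOrbitalIntegral_eq_mul_prod_of_eq_ofReal_smul_ofLocal
    (hanis : ∀ x : Fin N → L, hermForm (cmConjRingHom L) H x x = 0 → x = 0)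
    (hherm : (H.map (cmConjRingHom L)).transpose = H)
    (hadm : ∀ v, (mG v).IsAdmissibleOn fun x => IsRegularElt (x.val : GL (Fin N) (LocalRing L v)))
    (hadmA : mGi.IsAdmissibleOn fun a => IsRegularElt (a.val : GL (Fin N) (mixedEmbedding.mixedSpace L)))
    (hc : IsRegularElt ((Quotient.out c).val : GL (Fin N) L))
    (hnorm : ∃ S₀ : Finset (HeightOneSpectrum (𝓞 ↥(maximalRealSubfield L))),
      IsNormalisedOff L N H mG ((cmDatum L N H).toAdelic (Quotient.out c)) S₀)
    (μA : AdelicOrbitalMeasureFamily L N H) {r : ℝ} (hr : 0 ≤ r)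
    (hμA : μA c = ENNReal.ofReal r • AdelicOrbitalMeasureFamily.ofLocal L N H mG mGi c)
    (T : PureTensor L N H) (hT : T.IsTest) :
    ∃ S₂ : Finset (HeightOneSpectrum (𝓞 ↥(maximalRealSubfield L))), T.S ⊆ S₂ ∧
      adelicClassOrbitalIntegral L N H μA T.eval c =
        (r : ℂ) *
          (classOrbitalIntegral mGi T.arch
              (ConjClasses.mk (archPart (↥(maximalRealSubfield L)) L (IsCMField.complexConj L) N H ((cmDatum L N H).toAdelic (Quotient.out c)))) *
            ∏ v ∈ S₂, classOrbitalIntegral (mG v) (T.loc v)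
              (ConjClasses.mk ((cmDatum L N H).toLocal v ((cmDatum L N H).toAdelic (Quotient.out c))))) := by
  obtain ⟨S₂, hS₂, hprod⟩ := exists_finset_adelicClassOrbitalIntegral_eq_mul_prod_of_eq_smul_ofLocal L N H mG mGi c hanis hherm hadm hadmA
    hc hnorm μA (ENNReal.ofReal r) hμA T hT
  refine ⟨S₂, hS₂, ?_⟩
  rw [hprod, ENNReal.toReal_ofReal hr]

/-! ## §3 (ed. 2) The junk-free `∏ᶠ` reading and the `∀ S ⊇ S₁` shape (the currency of ★ `IsEulerOnClasses` ∕ ★ `AdelicDeltaTransfer`'s riders) -/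

/-- **The Euler product WITH ITS UNIT-FACTOR CLAUSE**: under the hypotheses of §1 there is a finite `S₂ ⊇ T.S` OFF WHICH THE LOCAL FACTORS
ARE `1` (`Φ_{mG v}(⟦γ_v⟧, T.loc v) = 1`, `v ∉ S₂` — Kottwitz's unit factors, ★ `exists_finset_forall_classOrbitalIntegral_loc_eq_one`) and over which
the product formula holds (★ `adelicClassOrbitalIntegral_ofLocal_eval_eq_mul_prod_of_isTest`). [cite: Rogawski1990, §4.3 p. 44; §5.4 (5.4.3) p. 72]
[cite: Kottwitz1986, Cor. 7.3] -/
theorem exists_finset_forall_loc_eq_one_and_ofLocal_eval_eq_mul_prod_of_isAdmissibleOn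
    (hanis : ∀ x : Fin N → L, hermForm (cmConjRingHom L) H x x = 0 → x = 0)
    (hherm : (H.map (cmConjRingHom L)).transpose = H)
    (hadm : ∀ v, (mG v).IsAdmissibleOn fun x => IsRegularElt (x.val : GL (Fin N) (LocalRing L v)))
    (hadmA : mGi.IsAdmissibleOn fun a => IsRegularElt (a.val : GL (Fin N) (mixedEmbedding.mixedSpace L)))
    (hc : IsRegularElt ((Quotient.out c).val : GL (Fin N) L))
    (hnorm : ∃ S₀ : Finset (HeightOneSpectrum (𝓞 ↥(maximalRealSubfield L))),
      IsNormalisedOff L N H mG ((cmDatum L N H).toAdelic (Quotient.out c)) S₀)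
    (T : PureTensor L N H) (hT : T.IsTest) :
    ∃ S₂ : Finset (HeightOneSpectrum (𝓞 ↥(maximalRealSubfield L))), T.S ⊆ S₂ ∧
      (∀ v, v ∉ S₂ →
        classOrbitalIntegral (mG v) (T.loc v) (ConjClasses.mk ((cmDatum L N H).toLocal v ((cmDatum L N H).toAdelic (Quotient.out c)))) = 1) ∧
      adelicClassOrbitalIntegral L N H (AdelicOrbitalMeasureFamily.ofLocal L N H mG mGi) T.eval c =
        classOrbitalIntegral mGi T.arch
            (ConjClasses.mk (archPart (↥(maximalRealSubfield L)) L (IsCMField.complexConj L) N H ((cmDatum L N H).toAdelic (Quotient.out c)))) *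
          ∏ v ∈ S₂, classOrbitalIntegral (mG v) (T.loc v) (ConjClasses.mk ((cmDatum L N H).toLocal v ((cmDatum L N H).toAdelic (Quotient.out c)))) := by
  obtain ⟨S₀, hS₀⟩ := hnorm
  have hadm' := fun v => isAdmissibleOn_at_toLocal_toAdelic L H v (hadm v) (Quotient.out c) hc
  have hadmA' := isAdmissibleOn_at_archPart_toAdelic L H hadmA (Quotient.out c) hc
  obtain ⟨S₂, hS₂, hf1⟩ := exists_finset_forall_classOrbitalIntegral_loc_eq_one L N H mG
    (unramifiedOrbitSetAE_of_hermitian L N H hherm (Godement.det_ne_zero_of_anisotropic L H hanis)) (Quotient.out c) hc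
    (fun v => (hadm' v).2.1) hS₀ T hT.isUnramified
  exact ⟨S₂, hS₂, hf1, adelicClassOrbitalIntegral_ofLocal_eval_eq_mul_prod_of_isTest L N H mG mGi c hanis hS₀ hadm' hadmA' T hT S₂ hf1⟩

/-- **The `∀ S ⊇ S₁` shape** (the shape of ★ `MatchingAdeleG.exists_isEulerOnClasses_ofLocalAdelic`'s conclusion, so finitely many classes can be read
over ONE common finite set of places): under the hypotheses of §1 there is a finite `S₁ ⊇ T.S` such that for EVERY finite `S ⊇ S₁`,
`Φ_{ofLocal mG mGi}(c, T.eval) = Φ_{mGi}(⟦γ_∞⟧, T.arch) · ∏_{v ∈ S} Φ_{mG v}(⟦γ_v⟧, T.loc v)`. [cite: Rogawski1990, §4.3 p. 44; §5.4 (5.4.3) p. 72]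
[cite: Kottwitz1986, Cor. 7.3] -/
theorem exists_finset_forall_ofLocal_eval_eq_mul_prod_of_subset_of_isAdmissibleOn
    (hanis : ∀ x : Fin N → L, hermForm (cmConjRingHom L) H x x = 0 → x = 0)
    (hherm : (H.map (cmConjRingHom L)).transpose = H)
    (hadm : ∀ v, (mG v).IsAdmissibleOn fun x => IsRegularElt (x.val : GL (Fin N) (LocalRing L v)))
    (hadmA : mGi.IsAdmissibleOn fun a => IsRegularElt (a.val : GL (Fin N) (mixedEmbedding.mixedSpace L)))
    (hc : IsRegularElt ((Quotient.out c).val : GL (Fin N) L))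
    (hnorm : ∃ S₀ : Finset (HeightOneSpectrum (𝓞 ↥(maximalRealSubfield L))),
      IsNormalisedOff L N H mG ((cmDatum L N H).toAdelic (Quotient.out c)) S₀)
    (T : PureTensor L N H) (hT : T.IsTest) :
    ∃ S₁ : Finset (HeightOneSpectrum (𝓞 ↥(maximalRealSubfield L))), T.S ⊆ S₁ ∧
      ∀ S : Finset (HeightOneSpectrum (𝓞 ↥(maximalRealSubfield L))), S₁ ⊆ S →
        adelicClassOrbitalIntegral L N H (AdelicOrbitalMeasureFamily.ofLocal L N H mG mGi) T.eval c =
          classOrbitalIntegral mGi T.arch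
              (ConjClasses.mk (archPart (↥(maximalRealSubfield L)) L (IsCMField.complexConj L) N H ((cmDatum L N H).toAdelic (Quotient.out c)))) *
            ∏ v ∈ S, classOrbitalIntegral (mG v) (T.loc v) (ConjClasses.mk ((cmDatum L N H).toLocal v ((cmDatum L N H).toAdelic (Quotient.out c)))) := by
  obtain ⟨S₀, hS₀⟩ := hnorm
  have hadm' := fun v => isAdmissibleOn_at_toLocal_toAdelic L H v (hadm v) (Quotient.out c) hc
  have hadmA' := isAdmissibleOn_at_archPart_toAdelic L H hadmA (Quotient.out c) hc
  obtain ⟨S₁, hS₁, hf1⟩ := exists_finset_forall_classOrbitalIntegral_loc_eq_one L N H mG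
    (unramifiedOrbitSetAE_of_hermitian L N H hherm (Godement.det_ne_zero_of_anisotropic L H hanis)) (Quotient.out c) hc
    (fun v => (hadm' v).2.1) hS₀ T hT.isUnramified
  exact ⟨S₁, hS₁, fun S hS => adelicClassOrbitalIntegral_ofLocal_eval_eq_mul_prod_of_isTest L N H mG mGi c hanis hS₀ hadm' hadmA' T hT S
    fun v hv => hf1 v fun hv₁ => hv (hS hv₁)⟩

/-- **The junk-free `∏ᶠ` reading**: under the hypotheses of §1 the local factors `v ↦ Φ_{mG v}(⟦γ_v⟧, T.loc v)` have FINITE multiplicative support and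
`Φ_{ofLocal mG mGi}(c, T.eval) = Φ_{mGi}(⟦γ_∞⟧, T.arch) · ∏ᶠ v, Φ_{mG v}(⟦γ_v⟧, T.loc v)` — «`Φ(γ, f) = Π_v Φ(γ, f_v)`», the honest finite product
(Mathlib `finprod_eq_prod_of_mulSupport_subset`); the shape ★ `AdelicDeltaTransfer` asks of `ofLocal` («no constant, `mulSupport` finite»).
[cite: Rogawski1990, §4.3 p. 44; §5.4 (5.4.3) p. 72] [cite: Kottwitz1986, Cor. 7.3] -/
theorem mulSupport_finite_and_ofLocal_eval_eq_mul_finprod_of_isAdmissibleOn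
    (hanis : ∀ x : Fin N → L, hermForm (cmConjRingHom L) H x x = 0 → x = 0)
    (hherm : (H.map (cmConjRingHom L)).transpose = H)
    (hadm : ∀ v, (mG v).IsAdmissibleOn fun x => IsRegularElt (x.val : GL (Fin N) (LocalRing L v)))
    (hadmA : mGi.IsAdmissibleOn fun a => IsRegularElt (a.val : GL (Fin N) (mixedEmbedding.mixedSpace L)))
    (hc : IsRegularElt ((Quotient.out c).val : GL (Fin N) L))
    (hnorm : ∃ S₀ : Finset (HeightOneSpectrum (𝓞 ↥(maximalRealSubfield L))),
      IsNormalisedOff L N H mG ((cmDatum L N H).toAdelic (Quotient.out c)) S₀)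
    (T : PureTensor L N H) (hT : T.IsTest) :
    (Function.mulSupport fun v : HeightOneSpectrum (𝓞 ↥(maximalRealSubfield L)) =>
        classOrbitalIntegral (mG v) (T.loc v) (ConjClasses.mk ((cmDatum L N H).toLocal v ((cmDatum L N H).toAdelic (Quotient.out c))))).Finite ∧
      adelicClassOrbitalIntegral L N H (AdelicOrbitalMeasureFamily.ofLocal L N H mG mGi) T.eval c =
        classOrbitalIntegral mGi T.arch
            (ConjClasses.mk (archPart (↥(maximalRealSubfield L)) L (IsCMField.complexConj L) N H ((cmDatum L N H).toAdelic (Quotient.out c)))) *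
          ∏ᶠ v, classOrbitalIntegral (mG v) (T.loc v) (ConjClasses.mk ((cmDatum L N H).toLocal v ((cmDatum L N H).toAdelic (Quotient.out c)))) := by
  obtain ⟨S₂, -, hf1, hprod⟩ := exists_finset_forall_loc_eq_one_and_ofLocal_eval_eq_mul_prod_of_isAdmissibleOn L N H mG mGi c hanis hherm hadm
    hadmA hc hnorm T hT
  have hsub : (Function.mulSupport fun v : HeightOneSpectrum (𝓞 ↥(maximalRealSubfield L)) =>
      classOrbitalIntegral (mG v) (T.loc v) (ConjClasses.mk ((cmDatum L N H).toLocal v ((cmDatum L N H).toAdelic (Quotient.out c))))) ⊆ ↑S₂ := by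
    intro v hv
    by_contra hvS
    exact hv (hf1 v (by simpa using hvS))
  exact ⟨S₂.finite_toSet.subset hsub, by rw [hprod, finprod_eq_prod_of_mulSupport_subset _ hsub]⟩

/-! ## §4 (ed. 3) The J-term: the STABLE orbital sum `Φ^st(𝒪_st(γ₀), f′) = Σ_{[γ] ⊂ 𝒪_st(γ₀)} Φ([γ], f′)` of the `ofLocal` family in Euler form, and
of a family that is a CONSTANT multiple of it on the stable class (the kit's `J(𝒪_st, f′) = 𝒪_st.orbitalSum Φ_{μA}(·, f′)`, pins (viii″)+(viii‴)) -/

/-- **THE STABLE ORBITAL SUM OF THE `ofLocal` FAMILY IN EULER FORM** at a regular stable class `𝒪_st(γ₀)` of the anisotropic hermitian `U(H)`: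
`Φ^st_{ofLocal mG mGi}(𝒪_st(γ₀), T.eval) = Σᶠ_{c ⊂ 𝒪_st(γ₀)} Φ_{mGi}(⟦γ_∞(c)⟧, T.arch) · ∏ᶠ_v Φ_{mG v}(⟦γ_v(c)⟧, T.loc v)` (`γ(c) = toAdelic (out c)`), each
product honest and finite (§3), provided the local family is normalised off some finite set at every class of the stable class (pin (xiv) at each
regular class). [cite: Rogawski1990, §4.1 (4.1.1) p. 39; §5.4 (5.4.3) p. 72; §14.5 p. 238] [cite: Kottwitz1986, Cor. 7.3] -/
theorem adelicStableOrbitalIntegral_ofLocal_eval_stableClassOf_eq_finsum_mul_finprod_of_isAdmissibleOn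
    (hanis : ∀ x : Fin N → L, hermForm (cmConjRingHom L) H x x = 0 → x = 0)
    (hherm : (H.map (cmConjRingHom L)).transpose = H)
    (hadm : ∀ v, (mG v).IsAdmissibleOn fun x => IsRegularElt (x.val : GL (Fin N) (LocalRing L v)))
    (hadmA : mGi.IsAdmissibleOn fun a => IsRegularElt (a.val : GL (Fin N) (mixedEmbedding.mixedSpace L)))
    {γ₀ : (cmDatum L N H).Rational} (hγ₀ : IsRegularElt (γ₀.val : GL (Fin N) L))
    (hnorm : ∀ c ∈ conjClassesIn (cmConjRingHom L) H γ₀, ∃ S₀ : Finset (HeightOneSpectrum (𝓞 ↥(maximalRealSubfield L))),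
      IsNormalisedOff L N H mG ((cmDatum L N H).toAdelic (Quotient.out c)) S₀)
    (T : PureTensor L N H) (hT : T.IsTest) :
    adelicStableOrbitalIntegral L N H (AdelicOrbitalMeasureFamily.ofLocal L N H mG mGi) T.eval (stableClassOf (cmConjRingHom L) H γ₀) =
      ∑ᶠ c ∈ conjClassesIn (cmConjRingHom L) H γ₀,
        classOrbitalIntegral mGi T.arch
            (ConjClasses.mk (archPart (↥(maximalRealSubfield L)) L (IsCMField.complexConj L) N H ((cmDatum L N H).toAdelic (Quotient.out c)))) *
          ∏ᶠ v, classOrbitalIntegral (mG v) (T.loc v) (ConjClasses.mk ((cmDatum L N H).toLocal v ((cmDatum L N H).toAdelic (Quotient.out c)))) := by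
  rw [adelicStableOrbitalIntegral_stableClassOf]
  refine finsum_mem_congr rfl fun c hc => ?_
  exact (mulSupport_finite_and_ofLocal_eval_eq_mul_finprod_of_isAdmissibleOn L N H mG mGi c hanis hherm hadm hadmA
    (isRegularElt_out_of_mem_conjClassesIn L N H hγ₀ hc) (hnorm c hc) T hT).2

/-- **THE KIT'S J-TERM IN EULER FORM** (β-socket shape): if `μA c = ENNReal.ofReal r • ofLocal mG mGi c` on the classes of the regular stable class
`𝒪_st(γ₀)` (`0 ≤ r`), then `Φ^st_{μA}(𝒪_st(γ₀), T.eval) = r · Σᶠ_{c ⊂ 𝒪_st(γ₀)} Φ_{mGi}(⟦γ_∞(c)⟧, T.arch) · ∏ᶠ_v Φ_{mG v}(⟦γ_v(c)⟧, T.loc v)` —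
«`J(𝒪_st, f′) = Σ_{γ ∈ 𝒪_st} a_γ Π_v Φ(γ, f′_v)`» with the weight constant on the stable class. [cite: Rogawski1990, §14.5 p. 238; §5.4 (5.4.3) p. 72]
[cite: Kottwitz1986, Cor. 7.3] -/
theorem adelicStableOrbitalIntegral_stableClassOf_eq_mul_finsum_mul_finprod_of_forall_eq_ofReal_smul_ofLocal
    (hanis : ∀ x : Fin N → L, hermForm (cmConjRingHom L) H x x = 0 → x = 0)
    (hherm : (H.map (cmConjRingHom L)).transpose = H)
    (hadm : ∀ v, (mG v).IsAdmissibleOn fun x => IsRegularElt (x.val : GL (Fin N) (LocalRing L v)))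
    (hadmA : mGi.IsAdmissibleOn fun a => IsRegularElt (a.val : GL (Fin N) (mixedEmbedding.mixedSpace L)))
    {γ₀ : (cmDatum L N H).Rational} (hγ₀ : IsRegularElt (γ₀.val : GL (Fin N) L))
    (hnorm : ∀ c ∈ conjClassesIn (cmConjRingHom L) H γ₀, ∃ S₀ : Finset (HeightOneSpectrum (𝓞 ↥(maximalRealSubfield L))),
      IsNormalisedOff L N H mG ((cmDatum L N H).toAdelic (Quotient.out c)) S₀)
    (μA : AdelicOrbitalMeasureFamily L N H) {r : ℝ} (hr : 0 ≤ r)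
    (hμA : ∀ c ∈ conjClassesIn (cmConjRingHom L) H γ₀, μA c = ENNReal.ofReal r • AdelicOrbitalMeasureFamily.ofLocal L N H mG mGi c)
    (T : PureTensor L N H) (hT : T.IsTest) :
    adelicStableOrbitalIntegral L N H μA T.eval (stableClassOf (cmConjRingHom L) H γ₀) =
      (r : ℂ) * ∑ᶠ c ∈ conjClassesIn (cmConjRingHom L) H γ₀,
        classOrbitalIntegral mGi T.arch
            (ConjClasses.mk (archPart (↥(maximalRealSubfield L)) L (IsCMField.complexConj L) N H ((cmDatum L N H).toAdelic (Quotient.out c)))) *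
          ∏ᶠ v, classOrbitalIntegral (mG v) (T.loc v) (ConjClasses.mk ((cmDatum L N H).toLocal v ((cmDatum L N H).toAdelic (Quotient.out c)))) := by
  rw [adelicStableOrbitalIntegral_stableClassOf_eq_toReal_mul_of_forall_eq_smul L N H μA (AdelicOrbitalMeasureFamily.ofLocal L N H mG mGi)
    (ENNReal.ofReal r) hμA, ENNReal.toReal_ofReal hr,
    adelicStableOrbitalIntegral_ofLocal_eval_stableClassOf_eq_finsum_mul_finprod_of_isAdmissibleOn L N H mG mGi hanis hherm hadm hadmA hγ₀ hnorm T hT]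

end Euler

end UnitaryGroup

end Literature.NumberTheory.Automorphic

end
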